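import Summits.AtomisticToContinuum.Crystallization.Theorems.FrustratedLawDichotomyStrainedPatchFrameCellsA
import Summits.AtomisticToContinuum.Crystallization.Theorems.FrustratedLawDichotomyPairPotentialDoorXMoves

/-!
# «FrameCells» (lens-5 g65 rev 3, 27623 T-side: frame charts, exact riding as a frame relation, frame cells / InFrameCells / FrameCellsCert, presented nets and the net theorem tubeP_of_frameNet_WSym, the frame loose witness and the HOLE TEST HoleAt/FixedHoleAt) — part 2 of 3 (sequel of `…FrustratedLawDichotomyStrainedPatchFrameCellsA`)

Split for the 400-line cap by the landing lane (hand-2 g30); the module docstring of part 1 (`…FrustratedLawDichotomyStrainedPatchFrameCellsA`) describes the whole node.  Same namespace; all FQNs unchanged.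
0 sorry; standard axioms.
-/

noncomputable section

namespace Summit.AtomisticToContinuum.Crystallization.Theorems.FrustratedLawDichotomyStrainedPatchFrameCells

open scoped BigOperators Classical RealInnerProductSpace
open Literature.Geometry.DiscreteGeometry (fccKissingPattern hcpKissingPattern card_fccKissingPattern card_hcpKissingPattern
  norm_eq_one_of_mem_fccKissingPattern norm_eq_one_of_mem_hcpKissingPattern one_le_dist_of_mem_fccKissingPattern one_le_dist_of_mem_hcpKissingPattern)
open Summit.AtomisticToContinuum.Crystallization.Theorems.FrustratedLawDichotomyPeriodicBlockFlags (goodAtScale_mono)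
open Summit.AtomisticToContinuum.Crystallization.Theorems.FrustratedLawDichotomyRangeCut (Sep)
open Summit.AtomisticToContinuum.Crystallization.Theorems.FrustratedLawDichotomyMotifLemmas
open Summit.AtomisticToContinuum.Crystallization.Theorems.FrustratedLawDichotomyAveragingCut
open Summit.AtomisticToContinuum.Crystallization.Theorems.FrustratedLawDichotomyAveragingRuleCap
open Summit.AtomisticToContinuum.Crystallization.Theorems.FrustratedLawDichotomyAveragingRuleTightFree
open Summit.AtomisticToContinuum.Crystallization.Theorems.FrustratedLawDichotomyExemptDoor (SitePred)
open Summit.AtomisticToContinuum.Crystallization.Theorems.FrustratedLawDichotomyExemptAbsorption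
open Summit.AtomisticToContinuum.Crystallization.Theorems.FrustratedLawDichotomyExemptAbsorptionRecord
open Summit.AtomisticToContinuum.Crystallization.Theorems.FrustratedLawDichotomyCollarCensus
open Summit.AtomisticToContinuum.Crystallization.Theorems.FrustratedLawDichotomyCollarCensusKappa
open Summit.AtomisticToContinuum.Crystallization.Theorems.FrustratedLawDichotomyStrainedPatchHomSplit
open Summit.AtomisticToContinuum.Crystallization.Theorems.FrustratedLawDichotomyStrainedPatchCleanCollar
open Summit.AtomisticToContinuum.Crystallization.Theorems.FrustratedLawDichotomyStrainedPatchHomTube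
open Summit.AtomisticToContinuum.Crystallization.Theorems.FrustratedLawDichotomyStrainedPatchHomPolar
open Summit.AtomisticToContinuum.Crystallization.Theorems.FrustratedLawDichotomyStrainedPatchHomIsometry
open Summit.AtomisticToContinuum.Crystallization.Theorems.FrustratedLawDichotomyStrainedPatchHomTubeIso
open Summit.AtomisticToContinuum.Crystallization.Theorems.FrustratedLawDichotomyStrainedPatchPhaseCut
open Summit.AtomisticToContinuum.Crystallization.Theorems.FrustratedLawDichotomyStrainedPatchCoreTube
open Summit.AtomisticToContinuum.Crystallization.Theorems.FrustratedLawDichotomyStrainedPatchCoreTubeRecord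
open Summit.AtomisticToContinuum.Crystallization.Theorems.FrustratedLawDichotomyStrainedPatchCoreTubeMilli
open Summit.AtomisticToContinuum.Crystallization.Theorems.FrustratedLawDichotomyStrainedPatchStrainBands
open Summit.AtomisticToContinuum.Crystallization.Theorems.FrustratedLawDichotomyStrainedPatchChartFamilies
open Summit.AtomisticToContinuum.Crystallization.Theorems.FrustratedLawDichotomyStrainedPatchChartFamiliesBent
open Summit.AtomisticToContinuum.Crystallization.Theorems.FrustratedLawDichotomyStrainedPatchChartFamiliesPinned
open Summit.AtomisticToContinuum.Crystallization.Theorems.FrustratedLawDichotomyStrainedPatchRecutPairs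
open Summit.AtomisticToContinuum.Crystallization.Theorems.FrustratedLawDichotomyStrainedPatchRecutKinematics
open Summit.AtomisticToContinuum.Crystallization.Theorems.FrustratedLawDichotomyStrainedPatchWindowFamilies
open Summit.AtomisticToContinuum.Crystallization.Theorems.FrustratedLawDichotomyStrainedPatchHostCells
open Summit.AtomisticToContinuum.Crystallization.Theorems.FrustratedLawDichotomyStrainedPatchGaugeCells


/-! ### §2b. ABSTRACT RIDING NETS: the net-level frame-cell theorem for the gauge family `FamG 𝒲`, over the tree
(62B's HOME-only `SymNet N` instantiates it DEFINITIONALLY: `R := N.ref`, `c := N.c`, `φ := N.φ`; `NetGood` ⟸ `CellsGood` ∧ `latVec_mem` (rev 3: injectivity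
instead of separation, see `NetGood`);
`netRef R c k G ξ b = bendAt b (N.ref k G ξ) (N.c k)` by `rfl`; `BoxesCoverW φ P 𝒲` = 62B `BoxesCover N P 𝒲`) -/

section Net
variable {K : ℕ} {Mk : Fin K → ℕ} {φ : Fin K → Bool} {R : (k : Fin K) → (E3 →L[ℝ] E3) → E3 → Fin (Mk k) → E3} {c : (k : Fin K) → Fin (Mk k)}
  {P : Fin K → (E3 →L[ℝ] E3) → E3 → Prop} {𝓑 : Set (E3 → E3)} {τ : ℝ} {𝓘 : (M₀ : ℕ) → (Fin M₀ → E3) → Fin M₀ → Prop}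
  {𝒲 : Bool → (E3 →L[ℝ] E3) → E3 → Prop}

-- `injective_of_sep` (7/10-separated configurations are injective) is the landed
-- `…FrustratedLawDichotomyPairPotentialDoorXMoves.injective_of_sep` (imported; dedup gate p850436).

/-- Bends of record fix the origin. [formal bookkeeping] -/
theorem bends0_zero {b : E3 → E3} (hb : b ∈ bends0) : b 0 = 0 := by
  obtain ⟨Q, C, -, -, h⟩ := hb
  rw [h 0]; simp

/-- `‖hcpShift‖ = 1`. [formal bookkeeping] -/
theorem norm_hcpShift : ‖hcpShift‖ = 1 := by
  have h2 : ‖hcpShift‖ ^ 2 = 1 := by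
    rw [EuclideanSpace.norm_sq_eq]
    simp [Fin.sum_univ_three, hcpShift, div_pow]
    norm_num
  nlinarith [norm_nonneg hcpShift]

/-- The corner `(U, ξ) = (3/4, −hcpShift/4)` lies in the symmetric quarter window. [formal bookkeeping] -/
theorem wSym_corner : WSym false ((3 / 4 : ℝ) • (1 : E3 →L[ℝ] E3)) (-(1 / 4 : ℝ) • hcpShift) := by
  refine ⟨?_, ?_, ?_, ?_⟩
  · intro v w
    have hv : ((3 / 4 : ℝ) • (1 : E3 →L[ℝ] E3)) v = (3 / 4 : ℝ) • v := by simp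
    have hw : ((3 / 4 : ℝ) • (1 : E3 →L[ℝ] E3)) w = (3 / 4 : ℝ) • w := by simp
    rw [hv, hw, real_inner_smul_left, real_inner_smul_right]
  · intro w
    have hw : ((3 / 4 : ℝ) • (1 : E3 →L[ℝ] E3)) w = (3 / 4 : ℝ) • w := by simp
    rw [hw, real_inner_smul_right]
    exact mul_nonneg (by norm_num) real_inner_self_nonneg
  · refine ContinuousLinearMap.opNorm_le_bound _ (by norm_num) fun x => ?_
    have hx : ((3 / 4 : ℝ) • (1 : E3 →L[ℝ] E3) - 1) x = (-(1 / 4) : ℝ) • x := by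
      rw [show ((3 / 4 : ℝ) • (1 : E3 →L[ℝ] E3) - 1) x = (3 / 4 : ℝ) • x - x by simp]
      module
    rw [hx, norm_smul, Real.norm_eq_abs]
    norm_num
  · rw [norm_smul, norm_neg, norm_hcpShift, Real.norm_eq_abs]; norm_num

/-- The corner lattice vector `U (hcpShift + ξ) = (9/16)·hcpShift`. [formal bookkeeping] -/
theorem corner_vec : ((3 / 4 : ℝ) • (1 : E3 →L[ℝ] E3)) (hcpShift + -(1 / 4 : ℝ) • hcpShift) = (9 / 16 : ℝ) • hcpShift := by
  rw [show ((3 / 4 : ℝ) • (1 : E3 →L[ℝ] E3)) (hcpShift + -(1 / 4 : ℝ) • hcpShift) = (3 / 4 : ℝ) • (hcpShift + -(1 / 4 : ℝ) • hcpShift) by simp]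
  module

/-- `norm_corner_vec` (docstring added by the landing lane; see the module docstring). [formal bookkeeping] -/
theorem norm_corner_vec : ‖((3 / 4 : ℝ) • (1 : E3 →L[ℝ] E3)) (hcpShift + -(1 / 4 : ℝ) • hcpShift)‖ = 9 / 16 := by
  rw [corner_vec, norm_smul, norm_hcpShift, Real.norm_eq_abs]; norm_num

/-- `corner_vec_mem` (docstring added by the landing lane; see the module docstring). [formal bookkeeping] -/
theorem corner_vec_mem : ((3 / 4 : ℝ) • (1 : E3 →L[ℝ] E3)) (hcpShift + -(1 / 4 : ℝ) • hcpShift) ∈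
    latSet false ((3 / 4 : ℝ) • (1 : E3 →L[ℝ] E3)) (-(1 / 4 : ℝ) • hcpShift) := by
  refine ⟨0, Or.inr ?_⟩
  simp [latPt]

/-- ★ **The symmetric quarter window contains hcp parameters whose lattice has a NONZERO vector of norm `9/16 < 7/10`** — so no clause of
`7/10`-separation on references can hold on a net whose boxes cover `WSym`; this is why `NetGood` asks INJECTIVITY (rev 3), the non-separated cells being
discharged by `frameDeadRef_of_close`. [formal bookkeeping] -/
theorem exists_wSym_latSet_norm_lt : ∃ (U : E3 →L[ℝ] E3) (ξ : E3), WSym false U ξ ∧ ∃ v ∈ latSet false U ξ, v ≠ 0 ∧ ‖v‖ < 7 / 10 := by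
  refine ⟨_, _, wSym_corner, _, corner_vec_mem, fun h => ?_, by rw [norm_corner_vec]; norm_num⟩
  have h9 := norm_corner_vec
  rw [h, norm_zero] at h9
  norm_num at h9

/-- **`NetGood φ R c P` [ELEMENTARY · census-checkable cell by cell]** — on every box `P k`, the symbolic reference `R k G ξ` is an INJECTIVE listing,
centred at the origin (`R k G ξ (c k) = 0`), within `14` of it, made of lattice vectors of `(φ k, G, ξ)`, and contains every such lattice vector of norm `≤ 10`.
(Rev 3: injectivity, NOT `7/10`-separation — the hcp corner of `WSym` (`U = 3/4`, `ξ = −hcpShift/4`) has lattice vectors `0` and `U (hcpShift + ξ)` at distance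
`9/16 < 7/10`, so a separation clause would make `NetGood ∧ BoxesCoverW φ P WSym` UNSATISFIABLE (rev 2's defect, refuted in kernel in the must-fail record);
cells whose reference is not `(7/10 − 2τ)`-separated on the `6`-ball host no admissible instance and are discharged by `frameDeadRef_of_close`.  SATISFIABLE
with the cover [V2, by recipe]: boxes of operator radius `≤ 1/10` about a finite net of the `U`-window × the offset ball, listing per box the lattice indices of
centre-norm `≤ 12` — norms then stay `≤ 14` and every vector of norm `≤ 10` anywhere in the box is listed; distinct indices give distinct vectors since `U` is
invertible and the two hcp cosets are disjoint for `‖ξ‖ ≤ 1/4`.) -/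
def NetGood (φ : Fin K → Bool) (R : (k : Fin K) → (E3 →L[ℝ] E3) → E3 → Fin (Mk k) → E3) (c : (k : Fin K) → Fin (Mk k))
    (P : Fin K → (E3 →L[ℝ] E3) → E3 → Prop) : Prop :=
  ∀ k G ξ, P k G ξ → Function.Injective (R k G ξ) ∧ R k G ξ (c k) = 0 ∧ (∀ a, ‖R k G ξ a‖ ≤ 14) ∧ (∀ a, R k G ξ a ∈ latSet (φ k) G ξ) ∧
    ∀ v ∈ latSet (φ k) G ξ, ‖v‖ ≤ 10 → ∃ a, R k G ξ a = v

/-- The bent reference of cell `(k, G, ξ, b)`: `a ↦ R k G ξ (c k) + b (R k G ξ a − R k G ξ (c k))` (62B's `bendAt b (N.ref k G ξ) (N.c k)`). -/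
def netRef (R : (k : Fin K) → (E3 →L[ℝ] E3) → E3 → Fin (Mk k) → E3) (c : (k : Fin K) → Fin (Mk k)) (k : Fin K) (G : E3 →L[ℝ] E3) (ξ : E3)
    (b : E3 → E3) : Fin (Mk k) → E3 :=
  fun a => R k G ξ (c k) + b (R k G ξ a - R k G ξ (c k))

/-- `netRef_sub_centre` (docstring added by the landing lane; see the module docstring). [formal bookkeeping] -/
theorem netRef_sub_centre {b : E3 → E3} (hb : b ∈ bends0) {k : Fin K} {G : E3 →L[ℝ] E3} {ξ : E3} (hc0 : R k G ξ (c k) = 0) (a : Fin (Mk k)) :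
    netRef R c k G ξ b a - netRef R c k G ξ b (c k) = b (R k G ξ a) := by
  simp only [netRef, hc0, sub_zero, zero_add, bends0_zero hb]

/-- **(ECᶠᴺ) `FrameNetCert R c P 𝓑 τ` [CERTIFICATE: one FRAME cell per (box, parameters, bend) · INSTRUMENTABLE]** — the frame twin of 62B's `ExactCert`. -/
def FrameNetCert (R : (k : Fin K) → (E3 →L[ℝ] E3) → E3 → Fin (Mk k) → E3) (c : (k : Fin K) → Fin (Mk k))
    (P : Fin K → (E3 →L[ℝ] E3) → E3 → Prop) (𝓑 : Set (E3 → E3)) (τ : ℝ) : Prop :=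
  ∀ k G ξ, P k G ξ → ∀ b ∈ 𝓑, FrameTubeFloor (netRef R c k G ξ b) (c k) τ

/-- The instances riding exactly (frame currency) on some cell of the net. -/
def InFrameNetCells (R : (k : Fin K) → (E3 →L[ℝ] E3) → E3 → Fin (Mk k) → E3) (c : (k : Fin K) → Fin (Mk k))
    (P : Fin K → (E3 →L[ℝ] E3) → E3 → Prop) (𝓑 : Set (E3 → E3)) (τ : ℝ) : (M₀ : ℕ) → (Fin M₀ → E3) → Fin M₀ → Prop :=
  fun M₀ h c₀ => ∃ (k : Fin K) (G : E3 →L[ℝ] E3) (ξ : E3), P k G ξ ∧ ∃ b ∈ 𝓑, RidesOn (netRef R c k G ξ b) (c k) τ M₀ h c₀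

/-- **`BoxesCoverW φ P 𝒲` [ELEMENTARY · finite-dimensional]** — the boxes cover the window, branch by branch (62B `BoxesCover`). -/
def BoxesCoverW (φ : Fin K → Bool) (P : Fin K → (E3 →L[ℝ] E3) → E3 → Prop) (𝒲 : Bool → (E3 →L[ℝ] E3) → E3 → Prop) : Prop :=
  ∀ φ' G ξ, 𝒲 φ' G ξ → ∃ k, φ k = φ' ∧ P k G ξ

/-- ★ (ECᶠᴺ) decides the tube floor over the part of any family the net's frame cells reach. [folklore] -/
theorem tubeFloor_of_frameNetCert (hcert : FrameNetCert R c P 𝓑 τ) :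
    TubeFloor (fun M₀ h c₀ => 𝓘 M₀ h c₀ ∧ InFrameNetCells R c P 𝓑 τ M₀ h c₀) τ := by
  intro M z cc M₀ h c₀ e hz hcl hm hch
  obtain ⟨k, G, ξ, hPk, b, hb, hr⟩ := hch.1.2
  obtain ⟨e', he'⟩ := frameChart_of_chartBy_of_ridesOn hch hr
  exact hcert k G ξ hPk b hb M z cc e' hz hcl hm he'

/-- ★★ (EVᶠᴺ) PROVED: every instance of the gauge family `FamG 𝒲` rides EXACTLY, in frame currency, on the bent reference of a cell of any good net whose
boxes cover the window (`ridesOn_of_presentedBy`; bends of record inside `𝓑`, `τ ≤ 3/10`). [folklore] -/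
theorem famLE_inFrameNetCells (h𝓑 : bends0 ⊆ 𝓑) (hτ : τ ≤ 3 / 10) (hg : NetGood φ R c P) (hB : BoxesCoverW φ P 𝒲) :
    FamilyLE (FamG 𝒲) (InFrameNetCells R c P 𝓑 τ) := by
  intro M₀ h c₀ hI
  have hinj : Function.Injective h := FrustratedLawDichotomyPairPotentialDoorXMoves.injective_of_sep (famG_sep 𝒲 M₀ h c₀ hI)
  obtain ⟨-, φ', b₀, G, ξ, hb₀, hW, hP⟩ := hI
  obtain ⟨k, hk, hPk⟩ := hB φ' G ξ hW
  obtain ⟨hRinj, hc0, h14, hlat, hcompl⟩ := hg k G ξ hPk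
  subst hk
  exact ⟨k, G, ξ, hPk, b₀, h𝓑 hb₀, ridesOn_of_presentedBy hb₀ hinj hP (R k G ξ) (fun a' => netRef_sub_centre hb₀ hc0 a') hRinj hc0 h14 hlat hcompl hτ⟩

/-- ★★★ THE NET-LEVEL FRAME-CELL THEOREM: `NetGood ∧ (ECᶠᴺ) ∧ boxes cover the window ⟹ TubeFloor (FamG 𝒲) τ`. [folklore] -/
theorem tubeFloor_famG_of_frameNet (h𝓑 : bends0 ⊆ 𝓑) (hτ : τ ≤ 3 / 10) (hg : NetGood φ R c P) (hcert : FrameNetCert R c P 𝓑 τ)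
    (hB : BoxesCoverW φ P 𝒲) : TubeFloor (FamG 𝒲) τ :=
  tubeFloor_split _ (tubeFloor_of_frameNetCert hcert)
    fun _ _ _ M₀ h c₀ _ _ _ _ hch => absurd (famLE_inFrameNetCells h𝓑 hτ hg hB M₀ h c₀ hch.1.1) hch.1.2

/-- … with a PARTIAL box family: (ECᶠᴺ) ∧ the tube floor over the instances not reached ⟹ the tube floor. [formal bookkeeping] -/
theorem tubeFloor_of_frameNetCert_of_remainder (hcert : FrameNetCert R c P 𝓑 τ)
    (hrem : TubeFloor (fun M₀ h c₀ => 𝓘 M₀ h c₀ ∧ ¬InFrameNetCells R c P 𝓑 τ M₀ h c₀) τ) : TubeFloor 𝓘 τ :=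
  tubeFloor_split _ (tubeFloor_of_frameNetCert hcert) hrem

/-- ★★★ (TF)ᴾ FROM FRAME CELLS (63G gauge + 62B exact riding, frame currency): for ANY rotatable window `𝒲`, any good net and box family covering it,
`FrameNetCert R c P bends0 (1/80) → TubeP`.  NO REMAINDER, NO SLOTS, NO BOND CONVERSION. -/
theorem tubeP_of_frameNet (hR : Rotatable 𝒲) (hg : NetGood φ R c P) (hcert : FrameNetCert R c P bends0 (1 / 80)) (hB : BoxesCoverW φ P 𝒲) :
    TubeP :=
  tubeP_of_tubeG_of_rotatable (tubeFloor_famG_of_frameNet (subset_refl _) (by norm_num) hg hcert hB) hR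

/-- … at the symmetric window of record `WSym` (63G `rotatable_WSym`). -/
theorem tubeP_of_frameNet_WSym (hg : NetGood φ R c P) (hcert : FrameNetCert R c P bends0 (1 / 80)) (hB : BoxesCoverW φ P WSym) : TubeP :=
  tubeP_of_frameNet rotatable_WSym hg hcert hB

/-- Per cell, (ECᶠᴺ) is discharged by ANY of: the energy certificate `FatTubeFloor … τ 0 0` (62B's cell obligation), a bond dead-witness `DeadRef … τ 0 0`
(63G/g64), or a frame dead-witness `FrameDeadRef … τ` (§3's hole test). [formal bookkeeping] -/
theorem frameNetCert_of_status
    (h : ∀ k G ξ, P k G ξ → ∀ b ∈ 𝓑, FrameDeadRef (netRef R c k G ξ b) (c k) τ ∨ DeadRef (netRef R c k G ξ b) (c k) τ 0 0 ∨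
      FatTubeFloor (netRef R c k G ξ b) (c k) τ 0 0) : FrameNetCert R c P 𝓑 τ :=
  fun k G ξ hP b hb => frameTubeFloor_of_status (h k G ξ hP b hb)

end Net

end Summit.AtomisticToContinuum.Crystallization.Theorems.FrustratedLawDichotomyStrainedPatchFrameCells
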